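import Literature.Probability.Percolation.EasoHutchcroftSnowballing
import Literature.Probability.Percolation.SharpnessQuasiTransitiveProofs
import Literature.Probability.Percolation.HalfSpace
import Literature.Barriers.CriticalPhenomena.SubexponentialGrowthZdBurtonKeane
import Literature.Barriers.CriticalPhenomena.AmenableUnimodular
import Literature.Barriers.CriticalPhenomena.TimarCriticalNonunimodular
import HarnessLib

/-!
# Near-critical long-range order on amenable transitive graphs of stretched-exponential growth: the STATEMENTS
# (`NearCriticalShortLRO`, its jump-world reading `JumpForcesShortLRO`), the engine shape `SnowballStep` they consume,
# and the KERNEL bridge from Easo–Hutchcroft's printed Proposition 4.1 (15) to that shape on amenable graphs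

Definitions file (`--supports stmt-CriticalPhenomena-4575`), lane `prim-bschramm`, seat `prim-bschramm-gen-1` gen 11 (GEN pen), lead g28's
RULING :498 STEP 1 (statement-first typing of the [W] ideation round's one unconditional negation theorem N1, w-idea-2 g5 CARD-5
«sprinkled-ghost-squeeze», door D11; refuter criteria F1–F5 of p5-g33).  builds on p205010 (kernel theorem, internal audit signed; external
expert review pending) — nothing in this file uses p205010.  No instance, no notation, no sorry, NO `@[conjecture]` (nothing here is asserted or
conjectured: the printed Easo–Hutchcroft proposition is a HYPOTHESIS wherever it is used, taken by name from
`Literature/Probability/Percolation/EasoHutchcroftSnowballing.lean`), nothing about `θ(p_c)` except INSIDE the hypothesis of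
`JumpForcesShortLRO`; the residue node, `Grigorchuk.stdCay_conj4` / `Grigorchuk.gzCay_conj4` and Conjecture 4 stay OPEN and are not mentioned by
any declaration.

CONTENT (all declarations generic in a locally finite simple graph `G`; the two Grigorchuk witnesses `Cay(𝔊; a,b,c,d)` / `Cay(𝔊 × ℤ; a,b,c,d,z)`
enter only in STEP 2, which instantiates them):
* §1 STATEMENT SHAPES (Props, nothing asserted): `GrowthLower G o a` — stretched-exponential volume growth `|B(o,m)| ≥ exp(c m^a)` eventually;
  `SnowballStepPow G d κ₃ κ₄` / `SnowballStep G d := SnowballStepPow G d 3 4` — the per-graph `Λ = V` snowballing implication (15) with loss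
  exponents `δ^{κ₃}` (station budget) and `δ^{κ₄}` (floor), for FINITE non-empty stations and sprinkling distance `δ ≤ 1`, with NO uniqueness clause
  (the shape appropriate to amenable graphs, where uniqueness holds at every `p`); `SnowballFact d` — "`SnowballStep G d` for every connected,
  transitive, amenable, `d`-regular `G`"; `SnowballDivergence G o d a κ` — the tower conclusion (a two-point floor at one scale forces `χ = ∞`
  after a sprinkle of size `≍ ((log(4/f) + 1)/m^a)^{1/κ}`); **`NearCriticalShortLRO G o a κ c`** (N1, the primary statement: jump-free and
  susceptibility-free) — for all large `m` and every `p ≤ p_c − C((log m + 1)/m^a)^{1/κ}`, `κ_p(3m) < m^{−c}`; `JumpForcesShortLRO` :=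
  `0 < θ_o(p_c) → NearCriticalShortLRO` (the ONLY place `θ(p_c)` occurs, as a hypothesis) with the one-line `jumpForcesShortLRO_of_nearCritical`.
* §2 PROVED SEAMS: `sprDist_ge` (room bound `δ(p,q) ≥ (q−p)/((1−p)·log(1/(1−q)))`), `not_summable_of_floor_tower` (floors `F_k ≤ κ_p(n_k)` with
  `F_k·|B(o,n_k)| → ∞` ⇒ `χ_p(o) = ∞`, over the kernel `kappa_mul_ballVolume_le_tsum`), `criticalProb_le_of_not_summable` (sharpness contrapositive
  over the kernel `DCTQ.summable_real_openConn_of_lt_criticalProb`: `χ_p = ∞ ⇒ p_c ≤ p` on connected quasi-transitive graphs).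
* §3 THE KERNEL BRIDGE `snowballStep_of_snowballing` / `snowballFact_of_snowballing`: Easo–Hutchcroft's PRINTED Prop. 4.1 (15)
  (`EasoHutchcroft2023_snowballing`, a hypothesis: unimodular transitive `d`-regular graphs with uniqueness on `[p₁,p₂]`) implies `SnowballFact d` —
  on a connected transitive amenable graph unimodularity is Lyons–Peres Prop. 8.14 (KERNEL: `isGraphUnimodular_of_isGraphAmenable`, «AmenableUnimodular»)
  and uniqueness at every `p` is Burton–Keane (KERNEL: `BurtonKeane1989_atMostOneInfiniteCluster_holds`, via the tree's
  `IsGraphTransitive.isQuasiTransitive`); `D = 1`.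
STATUS: N1 is NOT proved here (STEP 2 = the tower bookkeeping, conditional on `EasoHutchcroft2023_snowballing` by design); nothing about `θ(p_c)` on
either witness is claimed anywhere. [cite: EasoHutchcroft2023, Prop. 4.1 (15), Remark 4.1] [cite: Hutchcroft2016, §2] [cite: LyonsPeres2016, Prop. 8.14, Thm. 7.6]
-/

noncomputable section

namespace Summit.CriticalPhenomena.PercolationContinuityZ3.Theorems.Transplant

namespace SnowballSqueeze

open SimpleGraph MeasureTheory Filter Literature.Barriers.CriticalPhenomena Literature.Probability.Percolation
  Literature.Probability.Percolation.Snowballing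
open scoped Topology

variable {V : Type}

/-! ## §1 Statement shapes (Props; nothing asserted) -/

/-- **GrowthLower(a)** — stretched-exponential volume growth from the vertex `o`, in eventual form: `|B(o, m)| ≥ exp(c·m^a)` for some `c > 0`
and all large `m` (for `Cay(𝔊; a,b,c,d)` an exponent `a > 0` is kernel-reachable from the squaring inequality «GrigorchukSuperpolynomialGrowth»
`card_wordBall_sq_le`; the printed `a ↑ 0.7674` of Erschler–Zheng is NOT typed anywhere). [cite: Grigorchuk1984, Thm. (lower bound)] -/
def GrowthLower (G : SimpleGraph V) (o : V) (a : ℝ) : Prop :=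
  ∃ c : ℝ, 0 < c ∧ ∀ᶠ m : ℕ in atTop, Real.exp (c * (m : ℝ) ^ a) ≤ (ballVolume G o m : ℝ)

/-- **SnowballStepPow(d; κ₃, κ₄)** — the per-graph `Λ = V` snowballing implication of Easo–Hutchcroft Prop. 4.1 (15) with loss exponents `δ^{κ₃}`
(station budget) and `δ^{κ₄}` (floor), at sprinkling distances `δ(p₁, p₂) ≤ 1`: constants `c₁, h₀, c₂, c₃ > 0` such that for stations
`A 1, …, A n` (`n ≥ 1`; FINITE, non-empty), `1/d ≤ p₁ < p₂ < 1`, `0 < h ≤ h₀`, `h ≥ (min_i |A_i|)⁻¹`: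
`[h^{c₁δ^{κ₃}} ≤ c₃/n ∧ ∀ i < n, τ_{p₁}(A_i ∪ A_{i+1}) ≥ 4h^{c₁δ^{κ₄}}] ⇒ τ_{p₂}(A_1, A_n) ≥ c₂ τ_{p₁}(A_1) τ_{p₁}(A_n)`.  NO uniqueness clause: this is
the shape for AMENABLE graphs (uniqueness at every `p`, Burton–Keane).  Easo–Hutchcroft prove `(κ₃, κ₄) = (3, 4)` (`SnowballStep`); smaller `κ₄`
is door D11's conjectural lever K2 and is NOT claimed. [cite: EasoHutchcroft2023, Prop. 4.1 (15)] -/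
def SnowballStepPow (G : SimpleGraph V) (d : ℕ) (κ₃ κ₄ : ℝ) : Prop :=
  ∃ c₁ h₀ c₂ c₃ : ℝ, 0 < c₁ ∧ 0 < h₀ ∧ 0 < c₂ ∧ 0 < c₃ ∧
    ∀ (n : ℕ) (A : ℕ → Set V) (p₁ p₂ : unitInterval) (h : ℝ),
      1 ≤ n → (∀ i, 1 ≤ i → i ≤ n → (A i).Finite ∧ (A i).Nonempty) →
      (1 : ℝ) / d ≤ p₁ → (p₁ : ℝ) < p₂ → (p₂ : ℝ) < 1 → sprDist p₁ p₂ ≤ 1 →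
      0 < h → h ≤ h₀ → (∀ i, 1 ≤ i → i ≤ n → 1 ≤ h * ((A i).ncard : ℝ)) →
      h ^ (c₁ * sprDist p₁ p₂ ^ κ₃) ≤ c₃ / n →
      (∀ i, 1 ≤ i → i + 1 ≤ n → 4 * h ^ (c₁ * sprDist p₁ p₂ ^ κ₄) ≤ tauSet G p₁ (A i ∪ A (i + 1)) (A i ∪ A (i + 1))) →
      c₂ * tauSet G p₁ (A 1) (A 1) * tauSet G p₁ (A n) (A n) ≤ tauSet G p₂ (A 1) (A n)

/-- **SnowballStep(d)** = `SnowballStepPow G d 3 4`, the printed exponents of Easo–Hutchcroft Prop. 4.1 (15). [cite: EasoHutchcroft2023, Prop. 4.1 (15)] -/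
def SnowballStep (G : SimpleGraph V) (d : ℕ) : Prop := SnowballStepPow G d 3 4

/-- **SnowballFact(d)** — Prop. 4.1 (15) restricted to the class where its uniqueness and unimodularity hypotheses are automatic: every connected,
vertex-transitive (`IsGraphTransitive`), amenable (`IsGraphAmenable`), `d`-regular locally finite simple graph satisfies `SnowballStep G d`.  A
CONSEQUENCE of the printed proposition (`snowballFact_of_snowballing`, kernel bridge below); never asserted.
-- TODO(general form): unimodular transitive `G` with uniqueness on `[p₁, p₂]` only = `EasoHutchcroft2023_snowballing` itself.
[cite: EasoHutchcroft2023, Prop. 4.1 (15), Remark 4.1] -/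
def SnowballFact (d : ℕ) : Prop :=
  ∀ {W : Type} [DecidableEq W] (G : SimpleGraph W) [G.LocallyFinite],
    G.Connected → IsGraphTransitive G → IsGraphAmenable G → (∀ v : W, G.degree v = d) → SnowballStep G d

/-- **SnowballDivergence(d; a, κ)** — the tower conclusion (STEP 2's intermediate, support M; NOT proved here): a two-point floor
`f ≤ κ_{p₁}(3m)` at a large scale `m` forces `χ_o(p₂) = ∞` for every `p₂ > p₁` at sprinkling distance
`δ(p₁, p₂) ≥ C((log(4/f) + 1)/m^a)^{1/κ}` (from `SnowballStepPow … κ₃ κ` and `GrowthLower … a`: one step from scale `m` reaches scale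
`m·exp(c' m^{a/κ})`, the later steps cost geometrically less). [cite: EasoHutchcroft2023, Prop. 4.1 (15) and §4.2 (snowballing across scales)] -/
def SnowballDivergence (G : SimpleGraph V) (o : V) (d : ℕ) (a κ : ℝ) : Prop :=
  ∃ C : ℝ, ∃ m₀ : ℕ, 0 < C ∧ ∀ (m : ℕ) (f : ℝ) (p₁ p₂ : unitInterval), m₀ ≤ m → 0 < f →
    f ≤ kappa G p₁ (3 * m) → (1 : ℝ) / d ≤ p₁ → (p₁ : ℝ) < p₂ → (p₂ : ℝ) < 1 →
    C * ((Real.log (4 / f) + 1) / (m : ℝ) ^ a) ^ (1 / κ) ≤ sprDist p₁ p₂ →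
    ¬ Summable (fun x => (bondPercolation G p₂).real (openConn o x))

/-- **N1 — NearCriticalShortLRO(a, κ, c)**, the primary statement (negation side; NO jump hypothesis, NO susceptibility hypothesis): there are `C`
and `m₀` such that for every `m ≥ m₀` and every parameter `p ≤ p_c(o) − C·((log m + 1)/m^a)^{1/κ}`, the two-point floor `m^{−c}` at scale `3m`
FAILS: `κ_p(3m) < m^{−c}` — a near-critical long-range-order RADIUS law `R(ε) ≲ ε^{−κ/a}` up to logarithms.  To be PROVED in STEP 2 from
`SnowballStep` + `GrowthLower(a)` + sharpness + the room bound, CONDITIONALLY on `EasoHutchcroft2023_snowballing`; not proved here.  Intended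
instances (STEP 1b / STEP 2): W1 = `Cay(𝔊; a,b,c,d)` and W2 = `Cay(𝔊 × ℤ; a,b,c,d,z)` with `a` from `GrowthLower` (kernel, «GrigorchukWitnessSnowballStep»),
`κ = 4` (Easo–Hutchcroft's printed floor exponent), `c > 0` free.
[cite: EasoHutchcroft2023, Prop. 4.1 (15); §7.1 p. 139 (the case p = p_c is not treated in the source)] -/
def NearCriticalShortLRO (G : SimpleGraph V) (o : V) (a κ c : ℝ) : Prop :=
  ∃ C : ℝ, ∃ m₀ : ℕ, ∀ (m : ℕ) (p : unitInterval), m₀ ≤ m →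
    (p : ℝ) ≤ criticalProb G o - C * ((Real.log m + 1) / (m : ℝ) ^ a) ^ (1 / κ) →
    kappa G p (3 * m) < (m : ℝ) ^ (-c)

/-- **N1′ — JumpForcesShortLRO(a, κ, c)**: the jump-world reading of N1 — IF `θ_o(p_c) > 0` THEN `NearCriticalShortLRO` (in a jump world
`τ_{p_c} ≥ θ_o(p_c)²` everywhere by Harris–FKG and uniqueness, so N1 then says the long-range order present at `p_c` dies, at depth `ε`, before
radius `≍ ε^{−κ/a}`).  The hypothesis `0 < θ_o(p_c)` is the ONLY occurrence of `θ(p_c)` in this file; nothing is claimed about it.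
[cite: EasoHutchcroft2023, Prop. 4.1 (15)] [cite: BenjaminiSchramm1996, Conj. 4] -/
def JumpForcesShortLRO (G : SimpleGraph V) (o : V) (a κ c : ℝ) : Prop :=
  0 < theta G o (criticalProbIOf G o) → NearCriticalShortLRO G o a κ c

/-- N1 ⇒ N1′ (N1 carries no jump hypothesis, so its jump-world reading is a weakening). [folklore] -/
theorem jumpForcesShortLRO_of_nearCritical {G : SimpleGraph V} {o : V} {a κ c : ℝ} (h : NearCriticalShortLRO G o a κ c) :
    JumpForcesShortLRO G o a κ c := fun _ => h

/-! ## §2 Proved seams: the room bound, divergence from a tower of floors, sharpness contrapositive -/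

/-- **The room bound**: `δ(p, q) ≥ (q − p) / ((1 − p) · log(1/(1 − q)))` for `0 < p < q < 1` (two applications of `log x ≥ 1 − 1/x`:
`log(1/(1−q)) − log(1/(1−p)) ≥ (q−p)/(1−p)` and `log(u/v) ≥ 1 − v/u`).  In particular the depth `ε` below `q` costs at least `ε / log(1/(1−q))`
in sprinkling distance. [folklore] -/
theorem sprDist_ge {p q : ℝ} (hp : 0 < p) (hpq : p < q) (hq1 : q < 1) :
    (q - p) / ((1 - p) * -Real.log (1 - q)) ≤ sprDist p q := by
  have h1p : 0 < 1 - p := by linarith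
  have h1q : 0 < 1 - q := by linarith
  have hLp : 0 < -Real.log (1 - p) := by
    have := Real.log_neg h1p (by linarith); linarith
  have hLq : 0 < -Real.log (1 - q) := by
    have := Real.log_neg h1q (by linarith); linarith
  have hdiff : (q - p) / (1 - p) ≤ -Real.log (1 - q) - -Real.log (1 - p) := by
    have hx : 0 < (1 - p) / (1 - q) := div_pos h1p h1q
    have h := Real.one_sub_inv_le_log_of_pos hx
    rw [inv_div, Real.log_div h1p.ne' h1q.ne'] at h
    have h' : (q - p) / (1 - p) = 1 - (1 - q) / (1 - p) := by
      field_simp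
      ring
    linarith
  have hratio : Real.log (1 - q) / Real.log (1 - p) = (-Real.log (1 - q)) / (-Real.log (1 - p)) := by
    rw [neg_div_neg_eq]
  unfold sprDist
  rw [hratio]
  have hx : 0 < (-Real.log (1 - q)) / (-Real.log (1 - p)) := div_pos hLq hLp
  have h := Real.one_sub_inv_le_log_of_pos hx
  rw [inv_div] at h
  calc (q - p) / ((1 - p) * -Real.log (1 - q))
        = ((q - p) / (1 - p)) / (-Real.log (1 - q)) := by rw [div_div]
    _ ≤ (-Real.log (1 - q) - -Real.log (1 - p)) / (-Real.log (1 - q)) := by gcongr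
    _ = 1 - (-Real.log (1 - p)) / (-Real.log (1 - q)) := by rw [sub_div, div_self hLq.ne']
    _ ≤ _ := h

/-- **Divergence from a tower of floors**: if `F_k ≤ κ_p(n_k)` along a sequence of scales with `F_k · |B(o, n_k)| → ∞`, then `χ_p(o) = ∞`
(`Σ_y τ_p(o, y)` is not summable) — since `κ_p(n)·|B(o, n)| ≤ Σ_y τ_p(o, y)` (Hutchcroft 2016 §2, kernel `kappa_mul_ballVolume_le_tsum`).
[cite: Hutchcroft2016, §2 (proof of Thm. 2, first display)] -/
theorem not_summable_of_floor_tower (G : SimpleGraph V) [G.LocallyFinite] (p : unitInterval) (o : V) {F : ℕ → ℝ} {n : ℕ → ℕ}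
    (hF : ∀ k, F k ≤ kappa G p (n k)) (hdiv : Tendsto (fun k => F k * (ballVolume G o (n k) : ℝ)) atTop atTop) :
    ¬ Summable (fun x => (bondPercolation G p).real (openConn o x)) := by
  intro hs
  have hle : ∀ k, F k * (ballVolume G o (n k) : ℝ) ≤ ∑' y, (bondPercolation G p).real (openConn o y) :=
    fun k => (mul_le_mul_of_nonneg_right (hF k) (Nat.cast_nonneg _)).trans (kappa_mul_ballVolume_le_tsum G p o hs (n k))
  obtain ⟨k, hk⟩ := (hdiv.eventually (eventually_gt_atTop (∑' y, (bondPercolation G p).real (openConn o y)))).exists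
  exact absurd (hle k) (not_le.2 hk)

/-- **Sharpness, contrapositive**: on a connected, quasi-transitive, locally finite graph, `χ_p(o) = ∞` forces `p_c(o) ≤ p` (kernel
`DCTQ.summable_real_openConn_of_lt_criticalProb`: `p < p_c ⇒ Σ_x τ_p(o, x) < ∞`, Aizenman–Barsky / Duminil-Copin–Tassion).
[cite: DuminilCopinTassion2016, Thm. 1.1 (item 1)] -/
theorem criticalProb_le_of_not_summable (G : SimpleGraph V) [G.LocallyFinite] (hconn : G.Connected) (hq : IsQuasiTransitive G) (o : V)
    (p : unitInterval) (hns : ¬ Summable (fun x => (bondPercolation G p).real (openConn o x))) : criticalProb G o ≤ p := by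
  obtain ⟨V₀, hV₀⟩ := hq
  by_contra h
  push Not at h
  exact hns (DCTQ.summable_real_openConn_of_lt_criticalProb G hconn hV₀ o p h)

/-! ## §3 The kernel bridge: the printed Prop. 4.1 (15) ⇒ `SnowballStep` on connected transitive amenable graphs -/

/-- **THE BRIDGE (kernel).** Easo–Hutchcroft's printed Prop. 4.1 (15) — a HYPOTHESIS `hEH` — yields `SnowballStep G d` on every connected,
vertex-transitive, amenable, `d`-regular (`d ≥ 1`) locally finite graph: such a graph is unimodular (Lyons–Peres Prop. 8.14 / Soardi–Woess, KERNEL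
`isGraphUnimodular_of_isGraphAmenable`) and has at most one infinite cluster at EVERY `p` (Burton–Keane, KERNEL
`BurtonKeane1989_atMostOneInfiniteCluster_holds`), so the printed standing hypotheses hold on every `[p₁, p₂]`; take `D = 1`.
[cite: EasoHutchcroft2023, Prop. 4.1 (15), Remark 4.1] [cite: LyonsPeres2016, Prop. 8.14, Thm. 7.6] -/
theorem snowballStep_of_snowballing (hEH : EasoHutchcroft2023_snowballing) {W : Type} [DecidableEq W] (G : SimpleGraph W) [G.LocallyFinite]
    (hconn : G.Connected) (htrans : IsGraphTransitive G) (hamen : IsGraphAmenable G) {d : ℕ} (hd : 1 ≤ d) (hdeg : ∀ v : W, G.degree v = d) :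
    SnowballStep G d := by
  obtain ⟨c₂, c₃, hc₂, hc₃, HD⟩ := hEH
  obtain ⟨c₁, hc₁, Hd⟩ := HD 1
  obtain ⟨h₀, hh₀, H⟩ := Hd d hd
  refine ⟨c₁, h₀, c₂, c₃, hc₁, hh₀, hc₂, hc₃, ?_⟩
  intro n A p₁ p₂ h hn hA hp₁ hp₁₂ hp₂ hδ hh hhh₀ hcard hbudget hfloor
  have hunimod : IsGraphUnimodular G := isGraphUnimodular_of_isGraphAmenable G hconn htrans hamen
  have hp₁pos : 0 < (p₁ : ℝ) := by
    have : (0 : ℝ) < 1 / d := by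
      have : (1 : ℝ) ≤ d := by exact_mod_cast hd
      positivity
    linarith
  have huniq : ∀ p : unitInterval, (p₁ : ℝ) ≤ p → (p : ℝ) ≤ p₂ → ∀ᵐ ω ∂(bondPercolation G p), numInfiniteClusters ω ≤ 1 :=
    fun p _ _ =>
      haveI : Nonempty W := hconn.nonempty
      BurtonKeane1989_atMostOneInfiniteCluster_holds G hconn htrans.isQuasiTransitive hamen p
  have e3 : sprDist p₁ p₂ ^ (3 : ℝ) = sprDist p₁ p₂ ^ (3 : ℕ) := by
    rw [show (3 : ℝ) = ((3 : ℕ) : ℝ) by norm_num, Real.rpow_natCast]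
  have e4 : sprDist p₁ p₂ ^ (4 : ℝ) = sprDist p₁ p₂ ^ (4 : ℕ) := by
    rw [show (4 : ℝ) = ((4 : ℕ) : ℝ) by norm_num, Real.rpow_natCast]
  rw [e3] at hbudget
  exact H G hconn htrans hunimod hdeg n A p₁ p₂ h hn (fun i hi hin => (hA i hi hin).2) hp₁pos hp₁₂ hp₂ huniq
    (fun i hi hin _ => hcard i hi hin) hp₁ hδ hh hhh₀ hbudget (fun i hi hin => by rw [← e4]; exact hfloor i hi hin)

/-- **`EasoHutchcroft2023_snowballing ⟹ SnowballFact d`** for every `d ≥ 1` (the bridge, in the named-fact shape). Nothing asserted: the printed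
proposition stays a hypothesis. [cite: EasoHutchcroft2023, Prop. 4.1 (15), Remark 4.1] [cite: LyonsPeres2016, Prop. 8.14, Thm. 7.6] -/
theorem snowballFact_of_snowballing (hEH : EasoHutchcroft2023_snowballing) {d : ℕ} (hd : 1 ≤ d) : SnowballFact d :=
  fun G _ hconn htrans hamen hdeg => snowballStep_of_snowballing hEH G hconn htrans hamen hd hdeg

end SnowballSqueeze

end Summit.CriticalPhenomena.PercolationContinuityZ3.Theorems.Transplant
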